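import Summits.CriticalPhenomena.Ising3D.Control2DIsland

/-!
# The 2D Ising blind control, class 1 in TWO variables: rectangles, covers, and the island statement
(cell `pub-ising3x`, seat controls-1 gen 9; `SCOPE.md` §4 `### controls-1 v11`, rung B1′-b preparation)

HONEST FRAMING: lottery ticket; floor = tightest certified 3D Ising CFT bounds; no exact-solution
claim without a proof. CONTROL-ONLY: the two-dimensional axiom set `A2D′` (de la Fuente,
arXiv:1904.09801: `ε` the only `ℤ₂`-even scalar quasi-primary below a gap `G`, the stress tensor plus
a spin-2 gap `δ`, unitarity) is NOT the three-dimensional floor's axiom set.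

`Control2DIsland.lean` types the ONE-COLUMN objects (fixed `Δ_σ = s`): `BoxExcluded s G δ e₁ e₂`
(format `deriv-functional-2d/2`), pointwise exclusion `ExcludedAt s G δ x` of an `ε` location, and the
two-sided item `TwoSided`. The island rung B1′-b works in the `(Δ_σ, x)` PLANE:
* a format-`/3` certificate (`Dsigma_box = [σ₁, σ₂]`, `D` kept polynomial in both readers) asserts
  `RectExcluded G δ σ₁ σ₂ e₁ e₂`: the box exclusion holds at EVERY `Δ_σ ∈ [σ₁, σ₂]`;
* exclusions are collected POINTWISE in the pair `(Δ_σ, x)` (`ExcludedOn₂`), because box exclusions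
  do not union in the `ε` direction for data with several sub-gap scalars (warning in
  `Control2DIsland.lean`) while pointwise exclusions union freely (`excludedOn₂_union`,
  `excludedOn₂_iUnion`); a rectangle certificate gives the pointwise exclusion of its rectangle
  (`RectExcluded.excludedOn₂`), and `cover_strip.py`'s D-slab × ε-chain bookkeeping is
  `excludedOn₂_slab_of_chain` / `excludedOn₂_prod_Icc_append`;
* the ISLAND statement `Island G δ W B`: every `A2D′` datum at any `Δ_σ`, whose pair
  `(Δ_σ, x)` (`x` = the location of its sub-gap scalars) lies in the search window `W`, has that pair
  in `B`. It follows from the pointwise exclusion of `W \ B` (`island_of_cover`) — the 2D analogue of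
  the 3D target's `isingEnclosure_of_cover` — and the one-column item is the special case
  `W = {s} × [w, ∞)`, `B = univ × (ε_lo, U)` (`island_column_of_twoSided`, `twoSided_of_island_column`).
NOTHING numerical is asserted here: certificates are external exact-arithmetic objects checked by
two independent readers; this file fixes what a finite cover of them means.

Sources: linear-functional exclusion logic, R. Rattazzi, V. S. Rychkov, E. Tonni, A. Vichi,
JHEP 12 (2008) 031, §5; the 2D single-correlator island assumptions and search window,
A. de la Fuente, arXiv:1904.09801, §2–§3.
-/

namespace Summit.CriticalPhenomena.Ising3D.Control2D

open Set

/-- **Format-`/3` certificate (D-box)**: the kind-`box` exclusion `BoxExcluded s G δ e₁ e₂` holds at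
every external dimension `s ∈ [σ₁, σ₂]` (both readers keep the `Δ_σ` dependence exactly polynomial).
[cite: RattazziEtAl2008, §5] -/
def RectExcluded (G δ σ₁ σ₂ e₁ e₂ : ℝ) : Prop :=
  ∀ s ∈ Icc σ₁ σ₂, BoxExcluded s G δ e₁ e₂

/-- **Pointwise exclusion of a pair** `p = (Δ_σ, x)`: no `A2D′` datum at `Δ_σ = p.1` has its sub-gap
scalars at the single location `p.2`. [cite: RattazziEtAl2008, §5] -/
def ExcludedAt₂ (G δ : ℝ) (p : ℝ × ℝ) : Prop :=
  ExcludedAt p.1 G δ p.2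

/-- Pointwise exclusion of every pair in a plane set `W`. [cite: RattazziEtAl2008, §5] -/
def ExcludedOn₂ (G δ : ℝ) (W : Set (ℝ × ℝ)) : Prop :=
  ∀ p ∈ W, ExcludedAt₂ G δ p

/-- A smaller rectangle is excluded by a larger one. Elementary. [folklore] -/
theorem RectExcluded.mono {G δ σ₁ σ₂ e₁ e₂ σ₁' σ₂' e₁' e₂' : ℝ}
    (h : RectExcluded G δ σ₁ σ₂ e₁ e₂) (hσ₁ : σ₁ ≤ σ₁') (hσ₂ : σ₂' ≤ σ₂) (he₁ : e₁ ≤ e₁')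
    (he₂ : e₂' ≤ e₂) : RectExcluded G δ σ₁' σ₂' e₁' e₂' :=
  fun s hs => (h s (Icc_subset_Icc hσ₁ hσ₂ hs)).mono he₁ he₂

/-- A rectangle certificate restricted to one column is a box certificate. Elementary. [folklore] -/
theorem RectExcluded.boxExcluded {G δ σ₁ σ₂ e₁ e₂ s : ℝ} (h : RectExcluded G δ σ₁ σ₂ e₁ e₂)
    (hs : s ∈ Icc σ₁ σ₂) : BoxExcluded s G δ e₁ e₂ :=
  h s hs

/-- **A rectangle certificate excludes every pair of its rectangle.** Elementary. [folklore] -/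
theorem RectExcluded.excludedOn₂ {G δ σ₁ σ₂ e₁ e₂ : ℝ} (h : RectExcluded G δ σ₁ σ₂ e₁ e₂) :
    ExcludedOn₂ G δ (Icc σ₁ σ₂ ×ˢ Icc e₁ e₂) := by
  rintro ⟨s, x⟩ ⟨hs, hx⟩
  exact (h s hs).excludedAt hx

/-- Exclusion on a smaller plane set. Elementary. [folklore] -/
theorem ExcludedOn₂.mono {G δ : ℝ} {V W : Set (ℝ × ℝ)} (h : ExcludedOn₂ G δ W) (hVW : V ⊆ W) :
    ExcludedOn₂ G δ V :=
  fun p hp => h p (hVW hp)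

/-- Exclusion on a union of two plane sets. Elementary. [folklore] -/
theorem excludedOn₂_union {G δ : ℝ} {W₁ W₂ : Set (ℝ × ℝ)} (h₁ : ExcludedOn₂ G δ W₁)
    (h₂ : ExcludedOn₂ G δ W₂) : ExcludedOn₂ G δ (W₁ ∪ W₂) := by
  intro p hp
  rcases hp with hp | hp
  · exact h₁ p hp
  · exact h₂ p hp

/-- **Exclusion on an arbitrary union** (the shape of a finite cover `⋃ Q_i ⊇ W \ B`): if every
member of a family of plane sets is excluded pointwise, so is the union. Elementary. [folklore] -/
theorem excludedOn₂_iUnion {G δ : ℝ} {ι : Sort*} {S : ι → Set (ℝ × ℝ)}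
    (h : ∀ i, ExcludedOn₂ G δ (S i)) : ExcludedOn₂ G δ (⋃ i, S i) := by
  intro p hp
  rw [mem_iUnion] at hp
  obtain ⟨i, hi⟩ := hp
  exact h i p hi

/-- The one-column objects embed: pointwise exclusion of locations `W` at `Δ_σ = s` is pointwise
exclusion of the pairs `{s} × W`. Elementary. [folklore] -/
theorem excludedOn₂_singleton_prod {s G δ : ℝ} {W : Set ℝ} (h : ExcludedOn s G δ W) :
    ExcludedOn₂ G δ ({s} ×ˢ W) := by
  rintro ⟨s', x⟩ ⟨hs', hx⟩
  rw [mem_singleton_iff] at hs'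
  subst hs'
  exact h x hx

/-- **`cover_strip.py`, inner loop**: on one D-slab `[σ₁, σ₂]`, consecutive rectangle certificates
with `ε`-boxes `[e k, e (k+1)]`, `k ≤ n`, exclude every pair of `[σ₁, σ₂] × [e 0, e (n+1)]`
(column by column this is `excludedOn_of_chain`). PROVED. [folklore] -/
theorem excludedOn₂_slab_of_chain {G δ σ₁ σ₂ : ℝ} (e : ℕ → ℝ) (n : ℕ)
    (h : ∀ k, k ≤ n → RectExcluded G δ σ₁ σ₂ (e k) (e (k + 1))) :
    ExcludedOn₂ G δ (Icc σ₁ σ₂ ×ˢ Icc (e 0) (e (n + 1))) := by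
  rintro ⟨s, x⟩ ⟨hs, hx⟩
  exact excludedOn_of_chain e n (fun k hk => h k hk s hs) x hx

/-- **`cover_strip.py`, outer loop**: two D-slabs `[a, b]`, `[b', c]` with `b' ≤ b` and the same
`ε`-extent `E` give the slab `[a, c]`. Elementary. [folklore] -/
theorem excludedOn₂_prod_Icc_append {G δ a b b' c : ℝ} {E : Set ℝ}
    (h₁ : ExcludedOn₂ G δ (Icc a b ×ˢ E)) (h₂ : ExcludedOn₂ G δ (Icc b' c ×ˢ E)) (hbb : b' ≤ b) :
    ExcludedOn₂ G δ (Icc a c ×ˢ E) := by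
  rintro ⟨s, x⟩ ⟨hs, hx⟩
  rcases le_or_gt s b with hsb | hsb
  · exact h₁ (s, x) ⟨⟨hs.1, hsb⟩, hx⟩
  · exact h₂ (s, x) ⟨⟨hbb.trans hsb.le, hs.2⟩, hx⟩

/-- Shrinking the `ε`-extent of an excluded slab. Elementary. [folklore] -/
theorem excludedOn₂_prod_mono_right {G δ : ℝ} {S : Set ℝ} {E E' : Set ℝ}
    (h : ExcludedOn₂ G δ (S ×ˢ E)) (hE : E' ⊆ E) : ExcludedOn₂ G δ (S ×ˢ E') :=
  h.mono (prod_mono le_rfl hE)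

/-- **The island statement, typed** (`IslandExcluded2D` of `RB1/B1prime-PLAN.md` §1). `Island G δ W B`:
every parity-symmetric unitary solution of the 2D `⟨σσσσ⟩` sum rule at ANY external dimension `s`,
satisfying `A2D′` — sub-gap scalars at a single location `x` (scalars in `{x} ∪ [G, ∞)`), spin 2 in
`{2} ∪ [2 + δ, ∞)` — whose pair `(s, x)` lies in the search window `W`, has `(s, x) ∈ B`. For the 2D
Ising CFT (`(Δ_σ, Δ_ε) = (1/8, 1)`, next even scalar quasi-primary at `4`, next spin-2 quasi-primary
at `6`, so `A2D′` holds with `G = 2`, `δ = 1`) and `(1/8, 1) ∈ W` it says `(1/8, 1) ∈ B`. The window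
`W` is part of the statement, as in every published island computation (arXiv:1904.09801 §3 scans a
bounded `(Δ_σ, Δ_ε)` window). [cite: RattazziEtAl2008, §5] -/
def Island (G δ : ℝ) (W B : Set (ℝ × ℝ)) : Prop :=
  ∀ s x : ℝ, (s, x) ∈ W → ∀ D : CrossingData, D.IsUnitary → D.SatisfiesCrossing s →
    D.SpinTwoIn ({2} ∪ Ici (2 + δ)) → D.ScalarsIn ({x} ∪ Ici G) → (s, x) ∈ B

/-- **Assembly of the island from a cover**: pointwise exclusion of `W \ B` gives `Island G δ W B`
(what `cover_box.py` / `cover_strip.py`-style exact cover checks establish from finitely many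
rectangle certificates). PROVED. [cite: RattazziEtAl2008, §5] -/
theorem island_of_cover {G δ : ℝ} {W B : Set (ℝ × ℝ)} (hcov : ExcludedOn₂ G δ (W \ B)) :
    Island G δ W B := by
  intro s x hW D hU hC hT hS
  by_contra hB
  exact hcov (s, x) ⟨hW, hB⟩ D hU hC hS hT

/-- The cover may overshoot: any excluded plane set containing `W \ B` suffices. Elementary.
[folklore] -/
theorem island_of_cover_subset {G δ : ℝ} {W B C : Set (ℝ × ℝ)} (hC : ExcludedOn₂ G δ C)
    (hsub : W \ B ⊆ C) : Island G δ W B :=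
  island_of_cover (hC.mono hsub)

/-- A larger target box or a smaller window weakens the island statement. Elementary. [folklore] -/
theorem Island.mono {G δ : ℝ} {W W' B B' : Set (ℝ × ℝ)} (h : Island G δ W B) (hW : W' ⊆ W)
    (hB : B ⊆ B') : Island G δ W' B' :=
  fun s x hW' D hU hC hT hS => hB (h s x (hW hW') D hU hC hT hS)

/-- **The one-column item is a degenerate island**: `TwoSided s G δ w ε_lo U` gives the island with
window `{s} × [w, ∞)` and box `univ × (ε_lo, U)`. Elementary. [folklore] -/
theorem island_column_of_twoSided {s G δ w εlo U : ℝ} (h : TwoSided s G δ w εlo U) :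
    Island G δ ({s} ×ˢ Ici w) (univ ×ˢ Ioo εlo U) := by
  intro s' x hW D hU hC hT hS
  obtain ⟨hs', hx⟩ := hW
  rw [mem_singleton_iff] at hs'
  subst hs'
  exact ⟨mem_univ _, h D hU hC hT x hx hS⟩

/-- Conversely the degenerate island is the one-column item. Elementary. [folklore] -/
theorem twoSided_of_island_column {s G δ w εlo U : ℝ}
    (h : Island G δ ({s} ×ˢ Ici w) (univ ×ˢ Ioo εlo U)) : TwoSided s G δ w εlo U := by
  intro D hU hC hT x hwx hS
  have hmem := h s x ⟨mem_singleton _, hwx⟩ D hU hC hT hS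
  exact hmem.2

/-- **Projections of an island are two-sided data items**: if the island holds with box
`B = [σlo, σhi] × [εlo, εhi]` then every `A2D′` datum in the window has `σlo ≤ Δ_σ ≤ σhi` and
`εlo ≤ x ≤ εhi` — the two class-1 items (`Δ_σ`, `Δ_ε`) a blind round RB-2b would receive.
Elementary. [folklore] -/
theorem Island.projections {G δ σlo σhi εlo εhi : ℝ} {W : Set (ℝ × ℝ)}
    (h : Island G δ W (Icc σlo σhi ×ˢ Icc εlo εhi)) :
    ∀ s x : ℝ, (s, x) ∈ W → ∀ D : CrossingData, D.IsUnitary → D.SatisfiesCrossing s →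
      D.SpinTwoIn ({2} ∪ Ici (2 + δ)) → D.ScalarsIn ({x} ∪ Ici G) →
        (σlo ≤ s ∧ s ≤ σhi) ∧ (εlo ≤ x ∧ x ≤ εhi) := by
  intro s x hW D hU hC hT hS
  obtain ⟨hs, hx⟩ := h s x hW D hU hC hT hS
  exact ⟨⟨hs.1, hs.2⟩, ⟨hx.1, hx.2⟩⟩

end Summit.CriticalPhenomena.Ising3D.Control2D
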